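import Summits.Ventures.YMGap.RobustBall.LocalSourceResponse
import Summits.Ventures.YMGap.RobustBall.LocalSourceLoops
import Summits.Ventures.YMGap.RobustBall.UniformLoopCorrelatorDecay
import HarnessLib

/-!
# Venture YMGap, track ROBUST-BALL (Y2) — FEYNMAN–HELLMANN ON THE BALLS: exponentially small susceptibilities, the
# gauge-invariant and weighted balls, the Wilson point with one loop of any strength

HONEST FRAMING. WHAT THIS IS: a venture file (cell `pub-ymgap`, track Y2 ROBUST-BALL, seat rb-p1, theorems only), the ball readings of
`LocalSourceResponse.lean` (there: for a member with a unique DLR state `μ` and a local source `V`, every selection `ν s ∈ 𝒢(W + s·V)`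
has `d/ds ∫F dν_s = −cov_{ν_s}(F, H^V)` at every real `s`, and `ν 0 = μ`):
* `abs_cov_hamiltonian_le_of_perturbedClustering[S]` — with the clustering data `(m, A)` of the member (the body of every uniform
  currency of the track), `F` a Lipschitz cylinder on `Λ_F` and the source terms `V_A` Lipschitz cylinders on the sets `A ∈ T`
  disjoint from `Λ_F`: `|cov_μ(F, H^V)| ≤ A n² Σ_{A∈T} e^{−m d(Λ_F, A)} (K_F K_A + ‖F‖₂ ‖V_A‖₂)` — THE STATIC SUSCEPTIBILITY OF A LOCAL
  OBSERVABLE TO A LOCAL SOURCE IS EXPONENTIALLY SMALL IN THEIR SEPARATION, at the currency's rate;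
* `hasDerivAt_integral_of_uniformMassGapOnBallZdG`, `abs_susceptibility_le_of_uniformMassGapOnBallZdG` (ds-2's gauge-invariant
  ball), `hasDerivAt_integral_of_uniformMassGapOnBallZdS` (the weighted tier-2 ball);
* the WILSON POINT WITH ONE LOOP: for `SU(2)` on `ℤ⁴` at `0 ≤ β_W ≤ 1/3`, `t ↦ ⟨F⟩_{β_W, t·Re tr U_w/2}` is differentiable on `ℝ`
  with derivative `−cov(F, Re tr U_w/2)` in the unique state (`su2_wilson_singleLoop_hasDerivAt_upTo_oneThird`), and for
  `β_W ≤ 1/12` the susceptibility at `t = 0` is at most `32 n² 2^{−d(Λ_F, w)} (K_F √2|w| + ‖F‖₂‖Re tr U_w/2‖₂)`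
  (`su2_wilson_singleLoop_susceptibility_le_upTo_oneTwelfth`).
WHAT THIS IS NOT: no `s`-uniformity of the clustering of `ν_s` is claimed here (see `LocalSourceClustering.lean` and the screening
files); lattice, strong coupling (the rows); nothing about the continuum limit or a Clay-sense mass gap.
-/

noncomputable section

open MeasureTheory Function Finset Real ProbabilityTheory
open scoped NNReal
open Literature.Probability.LatticeModels
open Literature.MathematicalPhysics.QuantumLattice
open Literature.MathematicalPhysics.QuantumFieldTheory hiding ZdEdge Site

namespace Summit.Ventures.YMGap.RobustBall

variable {d N : ℕ}


/-! ### The susceptibility under clustering: exponentially small in the separation -/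

section Susceptibility

variable {β m A : ℝ} {W : Potential (ZdEdge d) (SUN N)} {supp : Finset (ZdEdge d) → Finset (Finset (ZdEdge d))}

/-- Bounded measurable functions on a probability space are in `L²`. -/
private theorem memLp_two_of_bdd {Ω : Type*} [MeasurableSpace Ω] {μ : Measure Ω} [IsProbabilityMeasure μ] {f : Ω → ℝ}
    (hf : Measurable f) {C : ℝ} (hC : ∀ x, |f x| ≤ C) : MemLp f 2 μ :=
  MemLp.of_bound hf.aestronglyMeasurable C (ae_of_all _ fun x => by rw [Real.norm_eq_abs]; exact hC x)

/-- **THE COVARIANCE WITH A LOCAL SOURCE ENERGY UNDER CLUSTERING.** If `μ` is a DLR state of a member with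
`PerturbedClustering d N β W supp m A`, `F` is a Lipschitz cylinder on `Λ_F` (`|Λ_F| ≤ n`), every `V_A` (`A ∈ T`) is a
Lipschitz cylinder on `A` (`|A| ≤ n`) and `Λ_F` is disjoint from every `A ∈ T`, then
`|cov_μ(F, Σ_{A∈T} V_A)| ≤ A n² Σ_{A∈T} e^{−m d(Λ_F, A)} (K_F K_A + ‖F‖₂ ‖V_A‖₂)`. -/
theorem abs_cov_hamiltonian_le_of_perturbedClustering (hcl : PerturbedClustering d N β W supp m A)
    {μ : Measure (LGConfig d (SUN N))} (hμ : μ ∈ perturbedGibbsMeasures (d := d) (fundamentalRep (Fin N)) (N * β) W supp)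
    {n : ℕ} {F : LGConfig d (SUN N) → ℝ} {ΛF : Finset (ZdEdge d)} {KF : ℝ≥0}
    (hF : IsLipschitzCylinder (fundamentalRep (Fin N)) F ΛF KF) (hΛF : ΛF.card ≤ n)
    {V : Potential (ZdEdge d) (SUN N)} {T : Finset (Finset (ZdEdge d))} {K : Finset (ZdEdge d) → ℝ≥0}
    (hV : ∀ A ∈ T, IsLipschitzCylinder (fundamentalRep (Fin N)) (V A) A (K A)) (hA : ∀ A ∈ T, A.card ≤ n)
    (hdisj : ∀ A ∈ T, Disjoint ΛF A) :
    |cov[F, fun U => ∑ A ∈ T, V A U; μ]| ≤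
      A * (n : ℝ) ^ 2 * ∑ A' ∈ T, Real.exp (-m * setDistEdges ΛF A') *
        ((KF : ℝ) * K A' + Real.sqrt (∫ U, F U ^ 2 ∂μ) * Real.sqrt (∫ U, V A' U ^ 2 ∂μ)) := by
  haveI := (show IsGibbsMeasure _ μ from hμ).isProbabilityMeasure
  have hFL : MemLp F 2 μ := memLp_two_of_bdd hF.measurable hF.abs_le
  have hVL : ∀ A' ∈ T, MemLp (V A') 2 μ := fun A' hA' => memLp_two_of_bdd (hV A' hA').measurable (hV A' hA').abs_le
  rw [covariance_fun_sum_right' hVL hFL, Finset.mul_sum]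
  refine (Finset.abs_sum_le_sum_abs _ _).trans (Finset.sum_le_sum fun A' hA' => ?_)
  have key := hcl μ hμ n F (V A') ΛF A' KF (K A') hΛF (hA A' hA') (hdisj A' hA') hF (hV A' hA')
  calc |cov[F, V A'; μ]| ≤ A * (n : ℝ) ^ 2 * Real.exp (-m * setDistEdges ΛF A') *
        ((KF : ℝ) * K A' + Real.sqrt (∫ U, F U ^ 2 ∂μ) * Real.sqrt (∫ U, V A' U ^ 2 ∂μ)) := key
    _ = A * (n : ℝ) ^ 2 * (Real.exp (-m * setDistEdges ΛF A') *
        ((KF : ℝ) * K A' + Real.sqrt (∫ U, F U ^ 2 ∂μ) * Real.sqrt (∫ U, V A' U ^ 2 ∂μ))) := by ring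

/-- The tier-2 twin: the same bound from `PerturbedClusteringS d N β W m A` for the DLR states of the summable member. -/
theorem abs_cov_hamiltonian_le_of_perturbedClusteringS (hcl : PerturbedClusteringS d N β W m A)
    {μ : Measure (LGConfig d (SUN N))} (hμ : μ ∈ perturbedGibbsMeasuresS (d := d) (fundamentalRep (Fin N)) (N * β) W)
    {n : ℕ} {F : LGConfig d (SUN N) → ℝ} {ΛF : Finset (ZdEdge d)} {KF : ℝ≥0}
    (hF : IsLipschitzCylinder (fundamentalRep (Fin N)) F ΛF KF) (hΛF : ΛF.card ≤ n)
    {V : Potential (ZdEdge d) (SUN N)} {T : Finset (Finset (ZdEdge d))} {K : Finset (ZdEdge d) → ℝ≥0}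
    (hV : ∀ A ∈ T, IsLipschitzCylinder (fundamentalRep (Fin N)) (V A) A (K A)) (hA : ∀ A ∈ T, A.card ≤ n)
    (hdisj : ∀ A ∈ T, Disjoint ΛF A) :
    |cov[F, fun U => ∑ A ∈ T, V A U; μ]| ≤
      A * (n : ℝ) ^ 2 * ∑ A' ∈ T, Real.exp (-m * setDistEdges ΛF A') *
        ((KF : ℝ) * K A' + Real.sqrt (∫ U, F U ^ 2 ∂μ) * Real.sqrt (∫ U, V A' U ^ 2 ∂μ)) := by
  haveI := (show IsGibbsMeasure _ μ from hμ).isProbabilityMeasure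
  have hFL : MemLp F 2 μ := memLp_two_of_bdd hF.measurable hF.abs_le
  have hVL : ∀ A' ∈ T, MemLp (V A') 2 μ := fun A' hA' => memLp_two_of_bdd (hV A' hA').measurable (hV A' hA').abs_le
  rw [covariance_fun_sum_right' hVL hFL, Finset.mul_sum]
  refine (Finset.abs_sum_le_sum_abs _ _).trans (Finset.sum_le_sum fun A' hA' => ?_)
  have key := hcl μ hμ n F (V A') ΛF A' KF (K A') hΛF (hA A' hA') (hdisj A' hA') hF (hV A' hA')
  calc |cov[F, V A'; μ]| ≤ A * (n : ℝ) ^ 2 * Real.exp (-m * setDistEdges ΛF A') *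
        ((KF : ℝ) * K A' + Real.sqrt (∫ U, F U ^ 2 ∂μ) * Real.sqrt (∫ U, V A' U ^ 2 ∂μ)) := key
    _ = A * (n : ℝ) ^ 2 * (Real.exp (-m * setDistEdges ΛF A') *
        ((KF : ℝ) * K A' + Real.sqrt (∫ U, F U ^ 2 ∂μ) * Real.sqrt (∫ U, V A' U ^ 2 ∂μ))) := by ring

end Susceptibility

/-! ### The gauge-invariant ball: differentiable response and exponentially small susceptibility -/

section BallG

variable {β ε₀ ε₁ m A : ℝ} {R : ℕ} {W : Potential (ZdEdge d) (SUN N)} {supp : Finset (ZdEdge d) → Finset (Finset (ZdEdge d))}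

/-- **ON A BALL CARRYING THE UNIFORM MASS-GAP CURRENCY THE RESPONSE TO EVERY LOCAL SOURCE IS DIFFERENTIABLE**, with the
Feynman–Hellmann derivative: for every member `(W, supp)` of `MemBallZdG ε₀ ε₁ R`, every adapted bounded source `V` with
finitely many listed terms, every selection `ν s ∈ 𝒢(W + s·V)` and every bounded measurable `F`,
`d/ds ∫ F dν_s |_{s=b} = −cov_{ν_b}(F, H^V)` at every real `b`. -/
theorem hasDerivAt_integral_of_uniformMassGapOnBallZdG (h : UniformMassGapOnBallZdG d N β ε₀ ε₁ R m A)
    (hW : MemBallZdG ε₀ ε₁ R W supp)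
    {V : Potential (ZdEdge d) (SUN N)} (hV : V.IsAdapted) (hVb : ∀ X, ∃ C, ∀ U, |V X U| ≤ C)
    {suppV : Finset (ZdEdge d) → Finset (Finset (ZdEdge d))} (hsuppV : V.IsSupportedBy suppV)
    {T : Finset (Finset (ZdEdge d))} (hT : ∀ Λ, suppV Λ ⊆ T)
    {ν : ℝ → Measure (LGConfig d (SUN N))}
    (hν : ∀ s, ν s ∈ perturbedGibbsMeasures (d := d) (fundamentalRep (Fin N)) (N * β) (W + s • V) (fun Λ => supp Λ ∪ suppV Λ))
    {F : LGConfig d (SUN N) → ℝ} (hFm : Measurable F) {C : ℝ} (hFb : ∀ U, |F U| ≤ C) (b : ℝ) :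
    HasDerivAt (fun s => ∫ U, F U ∂(ν s)) (-cov[F, fun U => ∑ A ∈ T, V A U; ν b]) b := by
  haveI : SecondCountableTopology (Matrix (Fin N) (Fin N) ℂ) :=
    inferInstanceAs (SecondCountableTopology (Fin N → Fin N → ℂ))
  haveI : SecondCountableTopology (SUN N) := Topology.IsEmbedding.subtypeVal.secondCountableTopology
  have hWa : W.IsAdapted := fun X => ⟨hW.dependsOn X, (hW.continuous X).measurable⟩
  have hWb : ∀ X, ∃ C, ∀ U, |W X U| ≤ C := fun X => exists_bound_of_continuous (hW.continuous X)
  obtain ⟨μ, hμ⟩ := (h.2 W supp hW).1.2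
  exact hasDerivAt_integral_of_mem_perturbedGibbsMeasures_add_smul (fundamentalRep (Fin N)) (continuous_fundamentalRep (Fin N))
    (N * β) hWa hWb hW.supportedBy hV hVb hsuppV hT (h.2 W supp hW).1.1 hμ hν hFm hFb b

/-- **AND THE SUSCEPTIBILITY AT THE MEMBER IS EXPONENTIALLY SMALL IN THE SEPARATION**: with `μ` the member's DLR state,
`ν 0 = μ` and `|d/ds|_{s=0} ∫ F dν_s| = |cov_μ(F, H^V)| ≤ A n² Σ_{A∈T} e^{−m d(Λ_F, A)} (K_F K_A + ‖F‖₂ ‖V_A‖₂)` for Lipschitz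
cylinders `F` (on `Λ_F`) and `V_A` (on `A`), `Λ_F` disjoint from the source sets, `|Λ_F|, |A| ≤ n`. -/
theorem abs_susceptibility_le_of_uniformMassGapOnBallZdG (h : UniformMassGapOnBallZdG d N β ε₀ ε₁ R m A)
    (hW : MemBallZdG ε₀ ε₁ R W supp)
    {μ : Measure (LGConfig d (SUN N))} (hμ : μ ∈ perturbedGibbsMeasures (d := d) (fundamentalRep (Fin N)) (N * β) W supp)
    {V : Potential (ZdEdge d) (SUN N)} (hVa : V.IsAdapted) (hVb : ∀ X, ∃ C, ∀ U, |V X U| ≤ C)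
    {suppV : Finset (ZdEdge d) → Finset (Finset (ZdEdge d))} (hsuppV : V.IsSupportedBy suppV)
    {T : Finset (Finset (ZdEdge d))} (hT : ∀ Λ, suppV Λ ⊆ T)
    {ν : ℝ → Measure (LGConfig d (SUN N))}
    (hν : ∀ s, ν s ∈ perturbedGibbsMeasures (d := d) (fundamentalRep (Fin N)) (N * β) (W + s • V) (fun Λ => supp Λ ∪ suppV Λ))
    {n : ℕ} {F : LGConfig d (SUN N) → ℝ} {ΛF : Finset (ZdEdge d)} {KF : ℝ≥0}
    (hF : IsLipschitzCylinder (fundamentalRep (Fin N)) F ΛF KF) (hΛF : ΛF.card ≤ n) {K : Finset (ZdEdge d) → ℝ≥0}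
    (hV : ∀ A ∈ T, IsLipschitzCylinder (fundamentalRep (Fin N)) (V A) A (K A)) (hA : ∀ A ∈ T, A.card ≤ n)
    (hdisj : ∀ A ∈ T, Disjoint ΛF A) :
    ∃ χ : ℝ, HasDerivAt (fun s => ∫ U, F U ∂(ν s)) χ 0 ∧
      |χ| ≤ A * (n : ℝ) ^ 2 * ∑ A' ∈ T, Real.exp (-m * setDistEdges ΛF A') *
        ((KF : ℝ) * K A' + Real.sqrt (∫ U, F U ^ 2 ∂μ) * Real.sqrt (∫ U, V A' U ^ 2 ∂μ)) := by
  haveI : SecondCountableTopology (Matrix (Fin N) (Fin N) ℂ) :=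
    inferInstanceAs (SecondCountableTopology (Fin N → Fin N → ℂ))
  haveI : SecondCountableTopology (SUN N) := Topology.IsEmbedding.subtypeVal.secondCountableTopology
  have hWa : W.IsAdapted := fun X => ⟨hW.dependsOn X, (hW.continuous X).measurable⟩
  have hWb : ∀ X, ∃ C, ∀ U, |W X U| ≤ C := fun X => exists_bound_of_continuous (hW.continuous X)
  obtain ⟨-, hder⟩ := hasDerivAt_integral_at_member (fundamentalRep (Fin N)) (continuous_fundamentalRep (Fin N)) (N * β)
    hWa hWb hW.supportedBy hVa hVb hsuppV hT (h.2 W supp hW).1.1 hμ hν hF.measurable hF.abs_le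
  refine ⟨_, hder, ?_⟩
  rw [abs_neg]
  exact abs_cov_hamiltonian_le_of_perturbedClustering (h.2 W supp hW).2 hμ hF hΛF hV hA hdisj

end BallG

/-! ### The weighted tier-2 ball -/

section BallS

/-- **ON THE WEIGHTED BALL OF A UNIFORM TIER-2 ROW**: for every member `W ∈ MemBallZdS a Λ t`, every source `V` with continuous
own-link terms and finitely many listed terms, every selection `ν s ∈ 𝒢_S(W + s·V)` and bounded measurable `F`:
`s ↦ ∫ F dν_s` is differentiable on `ℝ` with derivative `−cov_{ν_b}(F, H^V)`; `ν 0` is the member's state, where the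
susceptibility obeys `abs_cov_hamiltonian_le_of_perturbedClusteringS` with the row's `(m, A)`. -/
theorem hasDerivAt_integral_of_uniformMassGapOnBallZdS {β a Λ t m A : ℝ} (h : UniformMassGapOnBallZdS d N β a Λ t m A)
    {W : Potential (ZdEdge d) (SUN N)} (hW : MemBallZdS a Λ t W)
    {V : Potential (ZdEdge d) (SUN N)} (hVc : ∀ X, Continuous (V X)) (hVdep : ∀ X, DependsOn (V X) (↑X : Set (ZdEdge d)))
    {suppV : Finset (ZdEdge d) → Finset (Finset (ZdEdge d))} (hsuppV : V.IsSupportedBy suppV)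
    {T : Finset (Finset (ZdEdge d))} (hT : ∀ Λ, suppV Λ ⊆ T)
    {ν : ℝ → Measure (LGConfig d (SUN N))}
    (hν : ∀ s, ν s ∈ perturbedGibbsMeasuresS (d := d) (fundamentalRep (Fin N)) (N * β) (W + s • V))
    {F : LGConfig d (SUN N) → ℝ} (hFm : Measurable F) {C : ℝ} (hFb : ∀ U, |F U| ≤ C) (b : ℝ) :
    ν 0 ∈ perturbedGibbsMeasuresS (d := d) (fundamentalRep (Fin N)) (N * β) W ∧
      PerturbedClusteringS d N β W m A ∧
      HasDerivAt (fun s => ∫ U, F U ∂(ν s)) (-cov[F, fun U => ∑ A ∈ T, V A U; ν b]) b := by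
  haveI : SecondCountableTopology (Matrix (Fin N) (Fin N) ℂ) :=
    inferInstanceAs (SecondCountableTopology (Fin N → Fin N → ℂ))
  haveI : SecondCountableTopology (SUN N) := Topology.IsEmbedding.subtypeVal.secondCountableTopology
  obtain ⟨B, hB⟩ := hW.summable
  obtain ⟨μ, hμ⟩ := (h.2 W hW).1.2
  obtain ⟨h0, hder⟩ := hasDerivAt_integral_of_mem_perturbedGibbsMeasuresS_add_smul (fundamentalRep (Fin N))
    (continuous_fundamentalRep (Fin N)) (N * β) hB hW.continuous hW.dependsOn hVc hVdep hsuppV hT (h.2 W hW).1.1 hμ hν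
    hFm hFb b
  exact ⟨h0 ▸ hμ, (h.2 W hW).2, hder⟩

end BallS

/-! ### The Wilson point with one loop of any strength: `SU(2)`, `ℤ⁴` -/

section WilsonLoop

/-- **THE `SU(2)` WILSON POINT ON `ℤ⁴`, `0 ≤ β_W ≤ 1/3`, ONE LOOP OF ANY STRENGTH: THE RESPONSE IS DIFFERENTIABLE IN THE LOOP
COUPLING WITH THE FEYNMAN–HELLMANN DERIVATIVE.** For every closed walk `w`, every selection `ν t` of DLR states of the
action with `t · Re tr U_w/2` inserted (each is unique, `su2_wilson_singleLoop_hasUniqueGibbsMeasure_upTo_oneThird`) and every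
bounded measurable `F`: `d/dt ∫ F dν_t |_{t=b} = −cov_{ν_b}(F, Re tr U_w/2)` at every real `b`. -/
theorem su2_wilson_singleLoop_hasDerivAt_upTo_oneThird {βW : ℝ} (h0 : 0 ≤ βW) (h1 : βW ≤ 1 / 3)
    {x : Literature.Probability.LatticeModels.Site 4} (w : (zdGraph 4).Walk x x)
    {ν : ℝ → Measure (LGConfig 4 (SUN 2))}
    (hν : ∀ t, ν t ∈ perturbedGibbsMeasures (d := 4) (fundamentalRep (Fin 2)) (2 * (βW / 4))
      (loopFamilyAction 2 (fun _ : Unit => (⟨x, w⟩ : ZdLoop 4)) (fun _ => t))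
      (loopSupp (fun _ : Unit => (⟨x, w⟩ : ZdLoop 4))))
    {F : LGConfig 4 (SUN 2) → ℝ} (hFm : Measurable F) {C : ℝ} (hFb : ∀ U, |F U| ≤ C) (b : ℝ) :
    HasDerivAt (fun t => ∫ U, F U ∂(ν t)) (-cov[F, loopTerm (d := 4) 2 1 w; ν b]) b := by
  classical
  obtain ⟨m, -, hball⟩ := su2_uniformStar_upTo_oneThird
  have hmem : MemBallZdG (N := 2) (d := 4) (3 / 125) (3 / 250) 0 0 (fun _ => (∅ : Finset (Finset (ZdEdge 4)))) :=
    memBallZdG_zero (by norm_num) (by norm_num) 0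
  set γ : Unit → ZdLoop 4 := fun _ => ⟨x, w⟩ with hγ
  have hV := memBallZd_loopFamilyAction_fintype (N := 2) γ fun _ => (1 : ℝ)
  have hVa : (loopFamilyAction (d := 4) 2 γ fun _ => (1 : ℝ)).IsAdapted := fun X =>
    ⟨hV.dependsOn X, (hV.continuous X).measurable⟩
  have hVb : ∀ X, ∃ C, ∀ U, |loopFamilyAction (d := 4) 2 γ (fun _ => (1 : ℝ)) X U| ≤ C := fun X =>
    exists_bound_of_continuous (hV.continuous X)
  have hT : ∀ Λ, loopSupp γ Λ ⊆ Finset.univ.image fun i => walkEdges (γ i).walk := fun Λ =>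
    Finset.image_subset_image (Finset.subset_univ _)
  -- the family `t ↦ loop action with coupling t` is `0 + t • V`
  have hfam : ∀ t : ℝ, loopFamilyAction (d := 4) 2 γ (fun _ => t) = 0 + t • loopFamilyAction (d := 4) 2 γ fun _ => (1 : ℝ) := by
    intro t
    rw [zero_add, ← loopFamilyAction_smul]
    simp only [mul_one]
  have hν' : ∀ t, ν t ∈ perturbedGibbsMeasures (d := 4) (fundamentalRep (Fin 2)) (2 * (βW / 4))
      (0 + t • loopFamilyAction (d := 4) 2 γ fun _ => (1 : ℝ)) (fun Λ => (∅ : Finset (Finset (ZdEdge 4))) ∪ loopSupp γ Λ) := by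
    intro t
    have h := hν t
    rw [hfam t] at h
    simpa only [Finset.empty_union] using h
  have key := hasDerivAt_integral_of_uniformMassGapOnBallZdG (hball βW h0 h1 0) hmem hVa hVb hV.supportedBy hT hν' hFm hFb b
  have hH : (fun U : LGConfig 4 (SUN 2) => ∑ A ∈ Finset.univ.image (fun i => walkEdges (γ i).walk),
      loopFamilyAction (d := 4) 2 γ (fun _ => (1 : ℝ)) A U) = loopTerm (d := 4) 2 1 w :=
    funext fun U => sum_singleLoop_source w U
  rw [hH] at key
  exact key

/-- **THE `SU(2)` WILSON POINT ON `ℤ⁴`, `0 ≤ β_W ≤ 1/12`: THE SUSCEPTIBILITY TO ONE LOOP IS EXPONENTIALLY SMALL IN THE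
SEPARATION.** For the unique Wilson DLR state `μ`, every closed walk `w`, every selection `ν t` as above and every Lipschitz
cylinder `F` on `Λ_F` disjoint from the links of `w` (`|Λ_F|, |w-links| ≤ n`): `ν 0 = μ` and
`|d/dt|_{t=0} ∫ F dν_t| ≤ 32 n² 2^{−d(Λ_F, w)} (K_F · √2 |w| + ‖F‖₂ ‖Re tr U_w/2‖₂)` (rate `log 2`, constant `32` of
`su2_wilson_clustering_upTo_oneTwelfth`; `√2|w|` the Lipschitz constant of `Re tr U_w/2`). -/
theorem su2_wilson_singleLoop_susceptibility_le_upTo_oneTwelfth {βW : ℝ} (h0 : 0 ≤ βW) (h1 : βW ≤ 1 / 12)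
    {x : Literature.Probability.LatticeModels.Site 4} (w : (zdGraph 4).Walk x x)
    {μ : Measure (LGConfig 4 (SUN 2))} (hμ : μ ∈ ymGibbsMeasures (d := 4) (fundamentalRep (Fin 2)) (2 * (βW / 4)))
    {ν : ℝ → Measure (LGConfig 4 (SUN 2))}
    (hν : ∀ t, ν t ∈ perturbedGibbsMeasures (d := 4) (fundamentalRep (Fin 2)) (2 * (βW / 4))
      (loopFamilyAction 2 (fun _ : Unit => (⟨x, w⟩ : ZdLoop 4)) (fun _ => t))
      (loopSupp (fun _ : Unit => (⟨x, w⟩ : ZdLoop 4))))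
    {n : ℕ} {F : LGConfig 4 (SUN 2) → ℝ} {ΛF : Finset (ZdEdge 4)} {KF : ℝ≥0}
    (hF : IsLipschitzCylinder (fundamentalRep (Fin 2)) F ΛF KF) (hΛF : ΛF.card ≤ n) (hwn : (walkEdges w).card ≤ n)
    (hdisj : Disjoint ΛF (walkEdges w)) :
    ν 0 = μ ∧ ∃ χ : ℝ, HasDerivAt (fun t => ∫ U, F U ∂(ν t)) χ 0 ∧
      |χ| ≤ 32 * (n : ℝ) ^ 2 * Real.exp (-Real.log 2 * setDistEdges ΛF (walkEdges w)) *
        ((KF : ℝ) * (|(1 : ℝ)| * Real.sqrt (2 : ℕ) * w.length) +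
          Real.sqrt (∫ U, F U ^ 2 ∂μ) * Real.sqrt (∫ U, loopTerm (d := 4) 2 1 w U ^ 2 ∂μ)) := by
  classical
  have h13 : βW ≤ 1 / 3 := h1.trans (by norm_num)
  set γ : Unit → ZdLoop 4 := fun _ => ⟨x, w⟩ with hγ
  -- `ν 0` is a Wilson DLR state, hence `= μ`
  have huniq := su2_wilson_singleLoop_hasUniqueGibbsMeasure_upTo_oneThird h0 h13 w 0
  have hμ' : μ ∈ perturbedGibbsMeasures (d := 4) (fundamentalRep (Fin 2)) (2 * (βW / 4))
      (loopFamilyAction 2 γ (fun _ => (0 : ℝ))) (loopSupp γ) := by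
    rw [loopFamilyAction_zero]
    rw [show perturbedGibbsMeasures (d := 4) (fundamentalRep (Fin 2)) (2 * (βW / 4)) 0 (loopSupp γ) =
      ymGibbsMeasures (d := 4) (fundamentalRep (Fin 2)) (2 * (βW / 4)) from perturbedGibbsMeasures_zero _ _ _]
    exact hμ
  have h0eq : ν 0 = μ := huniq.1 (hν 0) hμ'
  have hder := su2_wilson_singleLoop_hasDerivAt_upTo_oneThird h0 h13 w hν hF.measurable hF.abs_le 0
  rw [h0eq] at hder
  refine ⟨h0eq, _, hder, ?_⟩
  rw [abs_neg]
  -- clustering of the Wilson state at rate log 2, constant 32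
  have hcl := su2_wilson_clustering_upTo_oneTwelfth h0 h1
  have hμ0 : μ ∈ perturbedGibbsMeasures (d := 4) (fundamentalRep (Fin 2)) (2 * (βW / 4)) 0
      (fun _ => (∅ : Finset (Finset (ZdEdge 4)))) := by
    rw [perturbedGibbsMeasures_zero]; exact hμ
  have key := hcl μ hμ0 n F (loopTerm (d := 4) 2 1 w) ΛF (walkEdges w) KF _ hΛF hwn hdisj hF
    (isLipschitzCylinder_loopTerm (N := 2) 1 w)
  exact key

end WilsonLoop

end Summit.Ventures.YMGap.RobustBall

end
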